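/-
Copyright (c) 2026 the pub-hodgecm-mathlib formalisation cell (harness21).  Prover seat hodgecm-mathlib-K2E1-p15 (g0), Track B ∕ K2-LIT «5Res (c) MS-2(χ,τ)», h413 =
`stmt-HodgeConjecture-24833`, line `K2_E1_TraceFormulaBeta`, route of record `HCCMUnconditional`; deal (115) of dealer K2E1-plan (g6) 2026-09-04T11:01:54Z = SHEET
`K2/K2-defs1/g6/SHEET-5Res-b-chi-twins.K2-defs1-g6.md` ROW 14 FILE 2; REPORT-FIRST `K2/STATUS.md` 11:04Z.
-/
import Summits.HodgeConjecture.HodgeConjecture.Theorems.K2E1MaassSelbergPairingCMTwo      -- ★ `pairing_of_differentiableOn`; brings ★ `…ContinuedCMTwo` (Schwarz reflection, identity theorem, quadrants), ★ `poleControl_of_fourTerm`, ★ `add_conj_sub_one_eq`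
import Summits.HodgeConjecture.HodgeConjecture.Theorems.K2E1MaassSelbergContinuedOnCMTwo  -- ★ p859569: `conj_mem_lower_of_mem` (and the scalar `_on` heads this file twins)
import HarnessLib

/-!
# K2·E1 — `K2E1ChiMaassSelbergContinuedCMTwo`: POLE CONTROL OF THE CONTINUED INTERTWINING OPERATOR `M(z, χ)` OF `U(1,1)_{L∕L⁺}` ON `Re z > ½`, `Im z ≠ 0`, FROM THE
# `(χ, τ)` MAASS–SELBERG RELATION — HYPOTHESIS-FIRST IN FOUR BRACKET LETTERS (the `(χ,τ)` twin of ★ `K2E1MaassSelbergContinuedCMTwo` ∕ ★ `K2E1MaassSelbergContinuedOnCMTwo`)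

Track B ∕ K2-LIT, crux h413 = `stmt-HodgeConjecture-24833`; cell `hodgecm-mathlib`, squad K2, ENGINE E1, campaign «5Res», road of record «BL-2(χ,τ) ∘ MS-2(χ,τ) ∘
ARCH-UNITARITY ∘ R8₂» (census K2E4-p23 (g2), TABLE 12th issue §F; SHEET row 14: (c) = FILE 1 `K2E1ChiMaassSelbergCMTwo` (the relation, K2E1-p14) + FILE 2 (its
consequences, this file)).  THEOREMS ONLY (no `def`, no `instance`, no notation, no named-fact hypothesis, no `sorry`); lane `--kind proof --supports
stmt-HodgeConjecture-24833 --as helper` (count-neutral).  Closes no socket.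

WHAT CHANGES WITH `(χ, τ)` ([MoeglinWaldspurger1995, IV.2.3, IV.3.12 (a)]).  The spherical files hard-wire the SCALAR `c̃(z)`: the four products `φ₀·conj φ₀`, `φ₀·conj(c̃(z′)φ₀)`,
`c̃(z)φ₀·conj φ₀`, `c̃(z)φ₀·conj(c̃(z′)φ₀)` of the four-term right side `R(z, z′; c̃)` (★ `differentiableOn_fourTerm_fst ∕ _snd_conj`, ★ `poleControl_continued_cm_two_of_pairing[_on]`).
For a cuspidal datum `(χ, τ)` on the Borel of `U(1,1)` the section space `V = V(χ, τ, U)` is finite-dimensional (★ p859551), `M(z, χ) : V → V′ = V(χʷ, τ, U)` is an OPERATOR, and the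
Maass–Selberg relation for `⟨Λ^T E(φ, z), Λ^T E(φ, z′)⟩` has the SAME four-term shape with the products replaced by four BRACKETS: `B₁ = a` (the `⟨φ, φ⟩`-bracket, a positive constant),
`B₂(z′)` (the `⟨φ, M(z′)φ⟩`-bracket, antiholomorphic in `z′`; identically `0` when `χ ≠ χʷ`, by orthogonality of characters on the compact norm-one idele class group), `B₃(z)`
(the `⟨M(z)φ, φ⟩`-bracket, holomorphic, `= conj B₂(z)` on the diagonal) and `B₄(z, z′)` (the `⟨M(z)φ, M(z′)φ⟩_{V′}`-bracket, holomorphic × antiholomorphic, `B₄(z, z) = b(z) ≥ 0`),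
tied by the Cauchy–Schwarz letter `‖B₂(z)‖² ≤ a·b(z)`.  THIS FILE runs [MW] IV.3.12 (a) in these letters, on an arbitrary open preconnected `D₁ ⊆ D⁺ = {Re z > ½, Im z > 0}` containing the
two sub-tube boxes (e.g. `D₁ = D⁺ ∖ P`, `P` the pole set — VERBATIM the `_on` binders of ★ p859569): the separately-holomorphic identity theorem ★ `eqOn_prod_of_separately_differentiableOn`
continues the relation from the sub-tube `1 < Re z′ < Re z` to `D₁ × D₁`, the diagonal `z′ = z` is real `≥ 0`, and ★ `poleControl_of_fourTerm` (which never saw the scalar) yields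
(a1) `√b(z) ≤ x·T^{2x}·√a∕|y| + √(x²T^{4x}a∕y² + aT^{4x})`, (a2) the box bound, (a3) `b(z) ≤ (…)²∕y²` for `|y| ≤ 1` (`x = Re z − ½`, `y = Im z`): **`‖M(z, χ)φ‖` HAS NO POLE ON
`½ < Re z ≤ 1` OFF THE REAL AXIS and is `O(|y|⁻¹)` on vertical approach**.  FILE 1 (K2E1-p14) instantiates the brackets (idele-class integrals `∫ ‖x‖·Ξᵢ`, or inner products on the
spaces of ★ p859551); the companion MODELS file discharges every bracket letter in the inner-product model and proves the `y`-FREE bound `b(z) ≤ T^{4x}·a` for `χ ≠ χʷ`.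

* §1 `differentiableOn_fourBracket_fst_on`, `differentiableOn_fourBracket_snd_conj_on` — holomorphy of `R(z, z′; B)` in `z ∈ D₁` and in `w = conj z′`.
* §2 `diag_eq_fourBracket_of_pairing_on` (the relation continued to `D₁ × D₁` and read on the diagonal — no positivity used) and HEAD **`poleControl_continued_chi_cm_two_of_pairing_on`** —
  (a1)∧(a2)∧(a3) for `b(z)` at every `z ∈ D₁`, modulo an abstract pairing `Φ` (the twin of ★ `…_of_pairing_on`).
* §3 FAMILY FORMS **`poleControl_continued_chi_cm_two_of_family_on`** (`F : ℂ → H` holomorphic into a complex Hilbert space, `⟪F z′, F z⟫ = R(z, z′; B)` on the sub-tube; ★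
  `pairing_of_differentiableOn`) and **`…_of_truncatedFamily_on`** (`H = L²(X, μ)`, `F z = [Λ^T E(φ, z)]` a.e. on the tube, the relation `h4` on `∫_X Λ^TE(z)·conj Λ^TE(z′) dμ` — THE
  SOCKET FILE 1 PAYS).
* MODELS (companion file `K2E1ChiMaassSelbergContinuedModelsCMTwo`, split for the 400-line law): every bracket letter discharged when the brackets are inner products `κm⟪·,·⟫`
  (`χ = χʷ`), and the `y`-FREE bound `b(z) ≤ T^{4x}·a` from the two-term relation (`χ ≠ χʷ`: no pole at all).

HONEST LABEL: HC_CM is proved only modulo the 7 printed citations (2 remaining named inputs: hLiu418 = `stmt-HodgeConjecture-24832`, h413 = `stmt-HodgeConjecture-24833`) until rung 0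
closes; this file asserts no named fact, is conditional by construction on the relation letters (`hrel` ∕ `h4`, FILE 1's socket), and closes no socket.

## References
* [MoeglinWaldspurger1995] C. Mœglin, J.-L. Waldspurger, *Spectral decomposition and Eisenstein series* (1995), II.1.7 (`M(w, π)`), IV.2.3 (Maass–Selberg), IV.3.12 (a) (pole control; continuation argument).
* [Arthur1980TraceFormulaII] J. Arthur, *A trace formula for reductive groups II*, Compositio Math. 40 (1980), §4 (inner product of truncated Eisenstein series).
* [GelbartRogawski1991] S. Gelbart, J. Rogawski, *L-functions and Fourier–Jacobi coefficients for the unitary group U(3)*, Invent. Math. 105 (1991), §3.1 (`U(1,1)`, `I(χ, s)`, `M(s)`).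
* [BernsteinLapid2019] J. Bernstein, E. Lapid, *On the meromorphic continuation of Eisenstein series*, J. AMS 37 (2024), §4.
-/

set_option autoImplicit false
set_option linter.dupNamespace false  -- the mandated namespace repeats the summit's segment (`HodgeConjecture.HodgeConjecture`)

noncomputable section

open MeasureTheory Measure NumberField IsDedekindDomain Set Filter Topology
open scoped ENNReal NNReal ComplexConjugate InnerProductSpace
open Literature.NumberTheory.Automorphic Literature.NumberTheory.Automorphic.UnitaryGroup AdelicGroupData
open Summit.HodgeConjecture.HodgeConjecture.Cruxes.H413.K2E1BorelEisensteinU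
open Summit.HodgeConjecture.HodgeConjecture.Cruxes.H413.K2E1MaassSelbergPoleControl (poleControl_of_fourTerm)
open Summit.HodgeConjecture.HodgeConjecture.Cruxes.H413.K2E1MaassSelbergPoleControlCMTwo (add_conj_sub_one_eq)
open Summit.HodgeConjecture.HodgeConjecture.Cruxes.H413.K2E1MaassSelbergContinuedCMTwo (differentiableOn_conj_comp_conj eqOn_prod_of_separately_differentiableOn add_sub_one_ne_zero_and_sub_ne_zero)
open Summit.HodgeConjecture.HodgeConjecture.Cruxes.H413.K2E1MaassSelbergPairingCMTwo (pairing_of_differentiableOn)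
open Summit.HodgeConjecture.HodgeConjecture.Cruxes.H413.K2E1MaassSelbergContinuedOnCMTwo (conj_mem_lower_of_mem)

namespace Summit.HodgeConjecture.HodgeConjecture.Cruxes.H413.K2E1ChiMaassSelbergContinuedCMTwo

/-! ## §1 The four-bracket right-hand side `R(z, z′; B)` is holomorphic in `z ∈ D₁` and in `w = conj z′ ∈ conj⁻¹ D₁` -/

section FourBracket

/-- **`R(·, z′; B)` is holomorphic in `z ∈ D₁`** (`D₁ ⊆ D⁺`) for `z′ ∈ D⁺`, `B₃` and `B₄(·, z′)` holomorphic on `D₁` (positive base `T`; the denominators `z + conj z′ − 1`, `z − conj z′` do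
not vanish on `D⁺ × D⁺`, ★ `add_sub_one_ne_zero_and_sub_ne_zero`). [cite: MoeglinWaldspurger1995, IV.3.12] -/
theorem differentiableOn_fourBracket_fst_on {D₁ : Set ℂ} (hD₁sub : D₁ ⊆ {z : ℂ | 1 / 2 < z.re ∧ 0 < z.im}) {T cμ K : ℝ} (hT : 0 < T)
    {B₁ : ℂ} {B₂ B₃ : ℂ → ℂ} {B₄ : ℂ → ℂ → ℂ} (hB₃ : DifferentiableOn ℂ B₃ D₁) {z' : ℂ} (hz' : z' ∈ {z : ℂ | 1 / 2 < z.re ∧ 0 < z.im})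
    (hB₄₁ : DifferentiableOn ℂ (fun z : ℂ => B₄ z z') D₁) :
    DifferentiableOn ℂ (fun z : ℂ =>
      ((cμ : ℝ) : ℂ) * (((K : ℝ) : ℂ) *
        ((((T : ℝ) : ℂ) ^ (z + conj z' - 1) / (z + conj z' - 1)) * B₁
          + (((T : ℝ) : ℂ) ^ (z - conj z') / (z - conj z')) * B₂ z'
          - (((T : ℝ) : ℂ) ^ (-(z - conj z')) / (z - conj z')) * B₃ z
          - (((T : ℝ) : ℂ) ^ (-(z + conj z' - 1)) / (z + conj z' - 1)) * B₄ z z'))) D₁ := by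
  have hT0 : ((T : ℝ) : ℂ) ≠ 0 := Complex.ofReal_ne_zero.2 hT.ne'
  have hw : conj z' ∈ {w : ℂ | 1 / 2 < w.re ∧ w.im < 0} := by
    obtain ⟨h1, h2⟩ := hz'
    refine ⟨?_, ?_⟩
    · show 1 / 2 < (conj z').re
      rw [Complex.conj_re]; exact h1
    · show (conj z').im < 0
      rw [Complex.conj_im]; linarith
  have hne : ∀ z ∈ D₁, z + conj z' - 1 ≠ 0 ∧ z - conj z' ≠ 0 := fun z hz => add_sub_one_ne_zero_and_sub_ne_zero (hD₁sub hz) hw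
  have hs₁ : DifferentiableOn ℂ (fun z : ℂ => z + conj z' - 1) D₁ := (differentiableOn_id.add_const _).sub_const _
  have hs₂ : DifferentiableOn ℂ (fun z : ℂ => z - conj z') D₁ := differentiableOn_id.sub_const _
  have e₁ : DifferentiableOn ℂ (fun z : ℂ => ((T : ℝ) : ℂ) ^ (z + conj z' - 1) / (z + conj z' - 1)) D₁ :=
    (hs₁.const_cpow (Or.inl hT0)).div hs₁ fun z hz => (hne z hz).1
  have e₂ : DifferentiableOn ℂ (fun z : ℂ => ((T : ℝ) : ℂ) ^ (z - conj z') / (z - conj z')) D₁ :=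
    (hs₂.const_cpow (Or.inl hT0)).div hs₂ fun z hz => (hne z hz).2
  have e₃ : DifferentiableOn ℂ (fun z : ℂ => ((T : ℝ) : ℂ) ^ (-(z - conj z')) / (z - conj z')) D₁ :=
    (hs₂.neg.const_cpow (Or.inl hT0)).div hs₂ fun z hz => (hne z hz).2
  have e₄ : DifferentiableOn ℂ (fun z : ℂ => ((T : ℝ) : ℂ) ^ (-(z + conj z' - 1)) / (z + conj z' - 1)) D₁ :=
    (hs₁.neg.const_cpow (Or.inl hT0)).div hs₁ fun z hz => (hne z hz).1
  exact (((((e₁.mul_const _).add (e₂.mul_const _)).sub (e₃.mul hB₃)).sub (e₄.mul hB₄₁)).const_mul _).const_mul _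

/-- **`R(z, conj w; B)` is holomorphic in `w ∈ D₂ = conj⁻¹ D₁`** for `z ∈ D⁺`, given the antiholomorphy letters `w ↦ B₂(conj w)`, `w ↦ B₄(z, conj w)` holomorphic on `D₂`.
[cite: MoeglinWaldspurger1995, IV.3.12] -/
theorem differentiableOn_fourBracket_snd_conj_on {D₁ : Set ℂ} (hD₁sub : D₁ ⊆ {z : ℂ | 1 / 2 < z.re ∧ 0 < z.im}) {T cμ K : ℝ} (hT : 0 < T)
    {B₁ : ℂ} {B₂ B₃ : ℂ → ℂ} {B₄ : ℂ → ℂ → ℂ} (hB₂ : DifferentiableOn ℂ (fun w : ℂ => B₂ (conj w)) {w : ℂ | conj w ∈ D₁}) {z : ℂ} (hz : z ∈ {z : ℂ | 1 / 2 < z.re ∧ 0 < z.im})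
    (hB₄₂ : DifferentiableOn ℂ (fun w : ℂ => B₄ z (conj w)) {w : ℂ | conj w ∈ D₁}) :
    DifferentiableOn ℂ (fun w : ℂ =>
      ((cμ : ℝ) : ℂ) * (((K : ℝ) : ℂ) *
        ((((T : ℝ) : ℂ) ^ (z + w - 1) / (z + w - 1)) * B₁
          + (((T : ℝ) : ℂ) ^ (z - w) / (z - w)) * B₂ (conj w)
          - (((T : ℝ) : ℂ) ^ (-(z - w)) / (z - w)) * B₃ z
          - (((T : ℝ) : ℂ) ^ (-(z + w - 1)) / (z + w - 1)) * B₄ z (conj w)))) {w : ℂ | conj w ∈ D₁} := by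
  have hT0 : ((T : ℝ) : ℂ) ≠ 0 := Complex.ofReal_ne_zero.2 hT.ne'
  have hne : ∀ w ∈ {w : ℂ | conj w ∈ D₁}, z + w - 1 ≠ 0 ∧ z - w ≠ 0 := fun w hw => add_sub_one_ne_zero_and_sub_ne_zero hz (conj_mem_lower_of_mem hD₁sub hw)
  have hs₁ : DifferentiableOn ℂ (fun w : ℂ => z + w - 1) {w : ℂ | conj w ∈ D₁} := ((differentiableOn_const z).add differentiableOn_id).sub_const _
  have hs₂ : DifferentiableOn ℂ (fun w : ℂ => z - w) {w : ℂ | conj w ∈ D₁} := (differentiableOn_const z).sub differentiableOn_id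
  have e₁ : DifferentiableOn ℂ (fun w : ℂ => ((T : ℝ) : ℂ) ^ (z + w - 1) / (z + w - 1)) {w : ℂ | conj w ∈ D₁} :=
    (hs₁.const_cpow (Or.inl hT0)).div hs₁ fun w hw => (hne w hw).1
  have e₂ : DifferentiableOn ℂ (fun w : ℂ => ((T : ℝ) : ℂ) ^ (z - w) / (z - w)) {w : ℂ | conj w ∈ D₁} :=
    (hs₂.const_cpow (Or.inl hT0)).div hs₂ fun w hw => (hne w hw).2
  have e₃ : DifferentiableOn ℂ (fun w : ℂ => ((T : ℝ) : ℂ) ^ (-(z - w)) / (z - w)) {w : ℂ | conj w ∈ D₁} :=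
    (hs₂.neg.const_cpow (Or.inl hT0)).div hs₂ fun w hw => (hne w hw).2
  have e₄ : DifferentiableOn ℂ (fun w : ℂ => ((T : ℝ) : ℂ) ^ (-(z + w - 1)) / (z + w - 1)) {w : ℂ | conj w ∈ D₁} :=
    (hs₁.neg.const_cpow (Or.inl hT0)).div hs₁ fun w hw => (hne w hw).1
  exact (((((e₁.mul_const _).add (e₂.mul hB₂)).sub (e₃.mul_const _)).sub (e₄.mul hB₄₂)).const_mul _).const_mul _

end FourBracket

/-! ## §2 Pole control on `D₁`, modulo the pairing, in bracket letters -/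

section Head

/-- **THE `(χ, τ)` MAASS–SELBERG RELATION CONTINUED TO `D₁ × D₁` AND READ ON THE DIAGONAL, IN BRACKET LETTERS.**  `D₁ ⊆ D⁺` open preconnected ⊇ the sub-tube boxes; `T > 0`;
bracket letters `B₁ ∈ ℂ` (constant), `B₂` (`w ↦ B₂(conj w)` holomorphic on `conj⁻¹ D₁`), `B₃` (holomorphic on `D₁`), `B₄` (holomorphic in `z ∈ D₁`, `w ↦ B₄(z, conj w)` holomorphic on `conj⁻¹ D₁`); a pairing
`Φ` holomorphic in `z ∈ D₁`, `w ↦ Φ z (conj w)` holomorphic on `conj⁻¹ D₁`, equal to `R(z, z′; B)` on the sub-tube `1 < Re z′ < Re z` inside `D₁ × D₁`.  THEN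
`Φ(z, z) = R(z, z; B)` at EVERY `z ∈ D₁` (★ `eqOn_prod_of_separately_differentiableOn` on `D₁ × conj⁻¹D₁` from the boxes `{3 < Re < 4} × {1 < Re < 2}`, §1 holomorphy, then the
diagonal `w = conj z`).  No positivity letter is used here. [cite: MoeglinWaldspurger1995, IV.3.12 (a)] [cite: Arthur1980TraceFormulaII, §4] -/
theorem diag_eq_fourBracket_of_pairing_on {D₁ : Set ℂ} (hD₁ : IsOpen D₁) (hD₁c : IsPreconnected D₁) (hD₁sub : D₁ ⊆ {z : ℂ | 1 / 2 < z.re ∧ 0 < z.im})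
    (hbox₁ : {z : ℂ | (3 < z.re ∧ z.re < 4) ∧ 0 < z.im} ⊆ D₁) (hbox₂ : {z : ℂ | (1 < z.re ∧ z.re < 2) ∧ 0 < z.im} ⊆ D₁)
    {T : ℝ} (hT0 : 0 < T) {cμ K : ℝ}
    {B₁ : ℂ} {B₂ B₃ : ℂ → ℂ} {B₄ : ℂ → ℂ → ℂ} (hB₂ : DifferentiableOn ℂ (fun w : ℂ => B₂ (conj w)) {w : ℂ | conj w ∈ D₁}) (hB₃ : DifferentiableOn ℂ B₃ D₁)
    (hB₄₁ : ∀ z' ∈ D₁, DifferentiableOn ℂ (fun z : ℂ => B₄ z z') D₁) (hB₄₂ : ∀ z ∈ D₁, DifferentiableOn ℂ (fun w : ℂ => B₄ z (conj w)) {w : ℂ | conj w ∈ D₁})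
    {Φ : ℂ → ℂ → ℂ}
    (hΦ₁ : ∀ z' ∈ D₁, DifferentiableOn ℂ (fun z : ℂ => Φ z z') D₁)
    (hΦ₂ : ∀ z ∈ D₁, DifferentiableOn ℂ (fun w : ℂ => Φ z (conj w)) {w : ℂ | conj w ∈ D₁})
    (hrel : ∀ z ∈ D₁, ∀ z' ∈ D₁, 1 < z'.re → z'.re < z.re →
      Φ z z' = ((cμ : ℝ) : ℂ) * (((K : ℝ) : ℂ) *
        ((((T : ℝ) : ℂ) ^ (z + conj z' - 1) / (z + conj z' - 1)) * B₁
          + (((T : ℝ) : ℂ) ^ (z - conj z') / (z - conj z')) * B₂ z'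
          - (((T : ℝ) : ℂ) ^ (-(z - conj z')) / (z - conj z')) * B₃ z
          - (((T : ℝ) : ℂ) ^ (-(z + conj z' - 1)) / (z + conj z' - 1)) * B₄ z z')))
    {z : ℂ} (hzD : z ∈ D₁) :
    Φ z z = ((cμ : ℝ) : ℂ) * (((K : ℝ) : ℂ) *
        ((((T : ℝ) : ℂ) ^ (z + conj z - 1) / (z + conj z - 1)) * B₁
          + (((T : ℝ) : ℂ) ^ (z - conj z) / (z - conj z)) * B₂ z
          - (((T : ℝ) : ℂ) ^ (-(z - conj z)) / (z - conj z)) * B₃ z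
          - (((T : ℝ) : ℂ) ^ (-(z + conj z - 1)) / (z + conj z - 1)) * B₄ z z)) := by
  -- (1) the identity on `D₁ × conj⁻¹D₁` in the variables `(z, w = conj z′)`
  set F : ℂ → ℂ → ℂ := fun z w => Φ z (conj w) with hF_def
  set G : ℂ → ℂ → ℂ := fun z w =>
      ((cμ : ℝ) : ℂ) * (((K : ℝ) : ℂ) *
        ((((T : ℝ) : ℂ) ^ (z + w - 1) / (z + w - 1)) * B₁
          + (((T : ℝ) : ℂ) ^ (z - w) / (z - w)) * B₂ (conj w)
          - (((T : ℝ) : ℂ) ^ (-(z - w)) / (z - w)) * B₃ z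
          - (((T : ℝ) : ℂ) ^ (-(z + w - 1)) / (z + w - 1)) * B₄ z (conj w))) with hG_def
  -- `D₂ := conj⁻¹ D₁` is open and preconnected
  have hD₂ : IsOpen {w : ℂ | conj w ∈ D₁} := hD₁.preimage Complex.continuous_conj
  have hD₂c : IsPreconnected {w : ℂ | conj w ∈ D₁} := by
    have h1 : {w : ℂ | conj w ∈ D₁} = (fun z : ℂ => conj z) '' D₁ := by
      ext w
      refine ⟨fun hw => ⟨conj w, hw, Complex.conj_conj w⟩, ?_⟩
      rintro ⟨z, hz1, rfl⟩
      show conj (conj z) ∈ D₁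
      rw [Complex.conj_conj]; exact hz1
    rw [h1]
    exact hD₁c.image _ Complex.continuous_conj.continuousOn
  have hconjD : ∀ w ∈ {w : ℂ | conj w ∈ D₁}, conj w ∈ D₁ := fun w hw => hw
  have hF₁ : ∀ w ∈ {w : ℂ | conj w ∈ D₁}, DifferentiableOn ℂ (fun z => F z w) D₁ := fun w hw => hΦ₁ (conj w) (hconjD w hw)
  have hG₁ : ∀ w ∈ {w : ℂ | conj w ∈ D₁}, DifferentiableOn ℂ (fun z => G z w) D₁ := fun w hw => by
    have h := differentiableOn_fourBracket_fst_on hD₁sub (cμ := cμ) (K := K) (B₁ := B₁) (B₂ := B₂) hT0 hB₃ (hD₁sub (hconjD w hw)) (hB₄₁ (conj w) (hconjD w hw))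
    simp only [Complex.conj_conj] at h
    exact h
  have hF₂ : ∀ z ∈ D₁, DifferentiableOn ℂ (fun w => F z w) {w : ℂ | conj w ∈ D₁} := fun z hz => hΦ₂ z hz
  have hG₂ : ∀ z ∈ D₁, DifferentiableOn ℂ (fun w => G z w) {w : ℂ | conj w ∈ D₁} := fun z hz =>
    differentiableOn_fourBracket_snd_conj_on hD₁sub (cμ := cμ) (K := K) (B₁ := B₁) (B₃ := B₃) hT0 hB₂ (hD₁sub hz) (hB₄₂ z hz)
  -- the box of the sub-tube: `O₁ = {3 < Re < 4, Im > 0} ⊆ D₁`, `O₂ = {1 < Re < 2, Im < 0} ⊆ D₂`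
  have hO₁ : IsOpen {z : ℂ | (3 < z.re ∧ z.re < 4) ∧ 0 < z.im} :=
    ((isOpen_lt continuous_const Complex.continuous_re).inter (isOpen_lt Complex.continuous_re continuous_const)).inter (isOpen_lt continuous_const Complex.continuous_im)
  have hO₂ : IsOpen {w : ℂ | (1 < w.re ∧ w.re < 2) ∧ w.im < 0} :=
    ((isOpen_lt continuous_const Complex.continuous_re).inter (isOpen_lt Complex.continuous_re continuous_const)).inter (isOpen_lt Complex.continuous_im continuous_const)
  have hO₁ne : ({z : ℂ | (3 < z.re ∧ z.re < 4) ∧ 0 < z.im} : Set ℂ).Nonempty := ⟨⟨7 / 2, 1⟩, by norm_num⟩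
  have hO₂ne : ({w : ℂ | (1 < w.re ∧ w.re < 2) ∧ w.im < 0} : Set ℂ).Nonempty := ⟨⟨3 / 2, -1⟩, by norm_num⟩
  have hO₂D : {w : ℂ | (1 < w.re ∧ w.re < 2) ∧ w.im < 0} ⊆ {w : ℂ | conj w ∈ D₁} := fun w hw =>
    hbox₂ ⟨⟨by rw [Complex.conj_re]; exact hw.1.1, by rw [Complex.conj_re]; exact hw.1.2⟩, by rw [Complex.conj_im]; linarith [hw.2]⟩
  have heq : ∀ z ∈ {z : ℂ | (3 < z.re ∧ z.re < 4) ∧ 0 < z.im}, ∀ w ∈ {w : ℂ | (1 < w.re ∧ w.re < 2) ∧ w.im < 0}, F z w = G z w := by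
    intro z hz w hw
    have h := hrel z (hbox₁ hz) (conj w) (hO₂D hw) (by rw [Complex.conj_re]; exact hw.1.1) (by rw [Complex.conj_re]; linarith [hw.1.2, hz.1.1])
    simp only [Complex.conj_conj] at h
    exact h
  have hid := eqOn_prod_of_separately_differentiableOn hD₁ hD₁c hD₂ hD₂c hO₁ hO₁ne hbox₁ hO₂ hO₂ne hO₂D hF₁ hG₁ hF₂ hG₂ heq
  -- (2) the diagonal `w = conj z`
  have hzc : conj z ∈ {w : ℂ | conj w ∈ D₁} := by
    show conj (conj z) ∈ D₁
    rw [Complex.conj_conj]; exact hzD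
  have hdiag := hid z hzD (conj z) hzc
  simp only [hF_def, hG_def, Complex.conj_conj] at hdiag
  exact hdiag

/-- **POLE CONTROL OF THE CONTINUED INTERTWINING OPERATOR FROM THE `(χ, τ)` MAASS–SELBERG RELATION, IN BRACKET LETTERS, ON AN OPEN PRECONNECTED `D₁ ⊆ D⁺` CONTAINING THE
SUB-TUBE BOXES** (the `(χ,τ)` twin of ★ `poleControl_continued_cm_two_of_pairing_on`).  Letters: `T ≥ 1`, `cμ, K > 0`; brackets `B₁ = a > 0` (`⟨φ, φ⟩`, a real cast — the side condition `hB₁`), `b ≥ 0` on `D₁` (`‖M(z)φ‖²`),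
`B₂` with `w ↦ B₂(conj w)` holomorphic on `conj⁻¹ D₁` (`⟨φ, M(z′)φ⟩`, `≡ 0` off the self-dual case), `B₃` holomorphic on `D₁` with `B₃ = conj B₂` there (`⟨M(z)φ, φ⟩`), `B₄` holomorphic
in `z ∈ D₁`, with `w ↦ B₄(z, conj w)` holomorphic on `conj⁻¹ D₁` and `B₄(z, z) = b(z)` (`⟨M(z)φ, M(z′)φ⟩`), Cauchy–Schwarz `‖B₂ z‖² ≤ a·b z`; a pairing `Φ` — to be
`⟨Λ^TẼ(φ, z), Λ^TẼ(φ, z′)⟩_{L²(X)}` — holomorphic in `z ∈ D₁`, `w ↦ Φ z (conj w)` holomorphic on `conj⁻¹ D₁`, equal to `R(z, z′; B)` on the sub-tube `1 < Re z′ < Re z` inside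
`D₁ × D₁`, and real `≥ 0` on the diagonal.  THEN at every `z ∈ D₁` (`x = Re z − ½`, `y = Im z`): (a1) `√b(z) ≤ x·T^{2x}·√a∕|y| + √(x²T^{4x}a∕y² + aT^{4x})`, (a2) the box bound,
(a3) `b(z) ≤ (…)²∕y²` for `|y| ≤ 1` — [MW] IV.3.12 (a) for the OPERATOR `M(z, χ)` tested on `φ` (`diag_eq_fourBracket_of_pairing_on`, then ★ `poleControl_of_fourTerm` with `W = B₂ z`).
[cite: MoeglinWaldspurger1995, IV.2.3, IV.3.12 (a)] [cite: Arthur1980TraceFormulaII, §4] -/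
theorem poleControl_continued_chi_cm_two_of_pairing_on {D₁ : Set ℂ} (hD₁ : IsOpen D₁) (hD₁c : IsPreconnected D₁) (hD₁sub : D₁ ⊆ {z : ℂ | 1 / 2 < z.re ∧ 0 < z.im})
    (hbox₁ : {z : ℂ | (3 < z.re ∧ z.re < 4) ∧ 0 < z.im} ⊆ D₁) (hbox₂ : {z : ℂ | (1 < z.re ∧ z.re < 2) ∧ 0 < z.im} ⊆ D₁)
    {T cμ K : ℝ} (hT : 1 ≤ T) (hcμ : 0 < cμ) (hK : 0 < K) {a : ℝ} (ha : 0 < a) {b : ℂ → ℝ} (hb : ∀ z ∈ D₁, 0 ≤ b z)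
    {B₁ : ℂ} {B₂ B₃ : ℂ → ℂ} {B₄ : ℂ → ℂ → ℂ} (hB₁ : B₁ = ((a : ℝ) : ℂ)) (hB₂ : DifferentiableOn ℂ (fun w : ℂ => B₂ (conj w)) {w : ℂ | conj w ∈ D₁}) (hB₃ : DifferentiableOn ℂ B₃ D₁)
    (hB₃₂ : ∀ z ∈ D₁, B₃ z = conj (B₂ z)) (hB₄₁ : ∀ z' ∈ D₁, DifferentiableOn ℂ (fun z : ℂ => B₄ z z') D₁)
    (hB₄₂ : ∀ z ∈ D₁, DifferentiableOn ℂ (fun w : ℂ => B₄ z (conj w)) {w : ℂ | conj w ∈ D₁}) (hB₄d : ∀ z ∈ D₁, B₄ z z = ((b z : ℝ) : ℂ))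
    (hCS : ∀ z ∈ D₁, ‖B₂ z‖ ^ 2 ≤ a * b z)
    {Φ : ℂ → ℂ → ℂ}
    (hΦ₁ : ∀ z' ∈ D₁, DifferentiableOn ℂ (fun z : ℂ => Φ z z') D₁)
    (hΦ₂ : ∀ z ∈ D₁, DifferentiableOn ℂ (fun w : ℂ => Φ z (conj w)) {w : ℂ | conj w ∈ D₁})
    (hrel : ∀ z ∈ D₁, ∀ z' ∈ D₁, 1 < z'.re → z'.re < z.re →
      Φ z z' = ((cμ : ℝ) : ℂ) * (((K : ℝ) : ℂ) *
        ((((T : ℝ) : ℂ) ^ (z + conj z' - 1) / (z + conj z' - 1)) * B₁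
          + (((T : ℝ) : ℂ) ^ (z - conj z') / (z - conj z')) * B₂ z'
          - (((T : ℝ) : ℂ) ^ (-(z - conj z')) / (z - conj z')) * B₃ z
          - (((T : ℝ) : ℂ) ^ (-(z + conj z' - 1)) / (z + conj z' - 1)) * B₄ z z')))
    {Q : ℂ → ℝ} (hQ : ∀ z ∈ D₁, 0 ≤ Q z ∧ Φ z z = ((Q z : ℝ) : ℂ))
    {z : ℂ} (hzD : z ∈ D₁) :
    Real.sqrt (b z) ≤ (z.re - 1 / 2) * T ^ (2 * (z.re - 1 / 2)) * Real.sqrt a / |z.im| +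
        Real.sqrt ((z.re - 1 / 2) ^ 2 * T ^ (4 * (z.re - 1 / 2)) * a / z.im ^ 2 + a * T ^ (4 * (z.re - 1 / 2))) ∧
      (∀ {x₁ x₂ η : ℝ}, 0 < x₁ → (z.re - 1 / 2) ∈ Set.Icc x₁ x₂ → 0 < η → η ≤ |z.im| →
        b z ≤ (x₂ * T ^ (2 * x₂) * Real.sqrt a / η + Real.sqrt (x₂ ^ 2 * T ^ (4 * x₂) * a / η ^ 2 + a * T ^ (4 * x₂))) ^ 2) ∧
      (|z.im| ≤ 1 → b z ≤ ((z.re - 1 / 2) * T ^ (2 * (z.re - 1 / 2)) * Real.sqrt a +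
        Real.sqrt ((z.re - 1 / 2) ^ 2 * T ^ (4 * (z.re - 1 / 2)) * a + a * T ^ (4 * (z.re - 1 / 2)))) ^ 2 / z.im ^ 2) := by
  have hT0 : 0 < T := lt_of_lt_of_le one_pos hT
  have hz : z ∈ {z : ℂ | 1 / 2 < z.re ∧ 0 < z.im} := hD₁sub hzD
  have hdiag := diag_eq_fourBracket_of_pairing_on hD₁ hD₁c hD₁sub hbox₁ hbox₂ hT0 hB₂ hB₃ hB₄₁ hB₄₂ hΦ₁ hΦ₂ hrel hzD
  obtain ⟨hQ0, hQeq⟩ := hQ z hzD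
  rw [hQeq] at hdiag
  -- ★ `poleControl_of_fourTerm` with `c₁ = cμ`, `c₂ = K`, `W = B₂ z`, `B₁ = a`, `B₃ = conj W`, `B₄ = b z`
  have hx : 0 < z.re - 1 / 2 := by linarith [hz.1]
  have hy : z.im ≠ 0 := ne_of_gt hz.2
  obtain ⟨hs₁, hs₂⟩ := add_conj_sub_one_eq z
  exact poleControl_of_fourTerm hcμ hK hT hx hy hQ0 ha (hb z hzD) (hCS z hzD) hs₁ hs₂ hB₁ (hB₃₂ z hzD) (hB₄d z hzD) hdiag

end Head

/-! ## §3 Family forms: an `H`-valued holomorphic family whose Gram pairing is the four-bracket on the sub-tube -/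

section Family

/-- **[MW] IV.3.12 (a) FOR `M(z, χ)` FROM A HILBERT-SPACE-VALUED HOLOMORPHIC FAMILY ON `D₁`** (the `(χ,τ)` twin of ★ `poleControl_continued_cm_two_of_family_on`, abstract Hilbert space):
`D₁ ⊆ D⁺` open preconnected ⊇ the sub-tube boxes; bracket letters as in §2; `F : ℂ → H` holomorphic on `D₁` into a complex inner-product space (to be `z ↦ [Λ^T Ẽ(φ, z)] ∈ L²(X, μ)`)
with `⟪F z′, F z⟫ = R(z, z′; B)` on the sub-tube `1 < Re z′ < Re z` inside `D₁ × D₁`.  THEN (a1)∧(a2)∧(a3) for `b` at every `z ∈ D₁` (★ `pairing_of_differentiableOn` supplies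
`hΦ₁ hΦ₂ hQ` for `Φ z z′ := ⟪F z′, F z⟫`, `Q z = ‖F z‖²`). [cite: MoeglinWaldspurger1995, IV.3.12 (a)] [cite: BernsteinLapid2019, §4] [cite: Arthur1980TraceFormulaII, §4] -/
theorem poleControl_continued_chi_cm_two_of_family_on {D₁ : Set ℂ} (hD₁ : IsOpen D₁) (hD₁c : IsPreconnected D₁) (hD₁sub : D₁ ⊆ {z : ℂ | 1 / 2 < z.re ∧ 0 < z.im})
    (hbox₁ : {z : ℂ | (3 < z.re ∧ z.re < 4) ∧ 0 < z.im} ⊆ D₁) (hbox₂ : {z : ℂ | (1 < z.re ∧ z.re < 2) ∧ 0 < z.im} ⊆ D₁)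
    {T cμ K : ℝ} (hT : 1 ≤ T) (hcμ : 0 < cμ) (hK : 0 < K) {a : ℝ} (ha : 0 < a) {b : ℂ → ℝ} (hb : ∀ z ∈ D₁, 0 ≤ b z)
    {B₁ : ℂ} {B₂ B₃ : ℂ → ℂ} {B₄ : ℂ → ℂ → ℂ} (hB₁ : B₁ = ((a : ℝ) : ℂ)) (hB₂ : DifferentiableOn ℂ (fun w : ℂ => B₂ (conj w)) {w : ℂ | conj w ∈ D₁}) (hB₃ : DifferentiableOn ℂ B₃ D₁)
    (hB₃₂ : ∀ z ∈ D₁, B₃ z = conj (B₂ z)) (hB₄₁ : ∀ z' ∈ D₁, DifferentiableOn ℂ (fun z : ℂ => B₄ z z') D₁)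
    (hB₄₂ : ∀ z ∈ D₁, DifferentiableOn ℂ (fun w : ℂ => B₄ z (conj w)) {w : ℂ | conj w ∈ D₁}) (hB₄d : ∀ z ∈ D₁, B₄ z z = ((b z : ℝ) : ℂ))
    (hCS : ∀ z ∈ D₁, ‖B₂ z‖ ^ 2 ≤ a * b z)
    {H : Type*} [NormedAddCommGroup H] [InnerProductSpace ℂ H] (F : ℂ → H) (hFd : DifferentiableOn ℂ F D₁)
    (hrel : ∀ z ∈ D₁, ∀ z' ∈ D₁, 1 < z'.re → z'.re < z.re →
      ⟪F z', F z⟫_ℂ = ((cμ : ℝ) : ℂ) * (((K : ℝ) : ℂ) *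
        ((((T : ℝ) : ℂ) ^ (z + conj z' - 1) / (z + conj z' - 1)) * B₁
          + (((T : ℝ) : ℂ) ^ (z - conj z') / (z - conj z')) * B₂ z'
          - (((T : ℝ) : ℂ) ^ (-(z - conj z')) / (z - conj z')) * B₃ z
          - (((T : ℝ) : ℂ) ^ (-(z + conj z' - 1)) / (z + conj z' - 1)) * B₄ z z')))
    {z : ℂ} (hz : z ∈ D₁) :
    Real.sqrt (b z) ≤ (z.re - 1 / 2) * T ^ (2 * (z.re - 1 / 2)) * Real.sqrt a / |z.im| +
        Real.sqrt ((z.re - 1 / 2) ^ 2 * T ^ (4 * (z.re - 1 / 2)) * a / z.im ^ 2 + a * T ^ (4 * (z.re - 1 / 2))) ∧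
      (∀ {x₁ x₂ η : ℝ}, 0 < x₁ → (z.re - 1 / 2) ∈ Set.Icc x₁ x₂ → 0 < η → η ≤ |z.im| →
        b z ≤ (x₂ * T ^ (2 * x₂) * Real.sqrt a / η + Real.sqrt (x₂ ^ 2 * T ^ (4 * x₂) * a / η ^ 2 + a * T ^ (4 * x₂))) ^ 2) ∧
      (|z.im| ≤ 1 → b z ≤ ((z.re - 1 / 2) * T ^ (2 * (z.re - 1 / 2)) * Real.sqrt a +
        Real.sqrt ((z.re - 1 / 2) ^ 2 * T ^ (4 * (z.re - 1 / 2)) * a + a * T ^ (4 * (z.re - 1 / 2)))) ^ 2 / z.im ^ 2) := by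
  obtain ⟨hΦ₁, hΦ₂, hQ⟩ := pairing_of_differentiableOn hD₁ hFd
  exact poleControl_continued_chi_cm_two_of_pairing_on hD₁ hD₁c hD₁sub hbox₁ hbox₂ hT hcμ hK ha hb hB₁ hB₂ hB₃ hB₃₂ hB₄₁ hB₄₂ hB₄d hCS
    (Φ := fun z z' => ⟪F z', F z⟫_ℂ) hΦ₁ hΦ₂ hrel (Q := fun z => ‖F z‖ ^ 2) hQ hz

variable (L : Type) [Field L] [NumberField L] [IsCMField L]
variable [MeasurableSpace (quasiSplit (↥(maximalRealSubfield L)) L (IsCMField.complexConj L) 2).Adelic]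

/-- **[MW] IV.3.12 (a) FOR `M(z, χ)` AT THE CM PAIR FROM THE CONTINUED TRUNCATED FAMILY IN `L²(X, μ)` AND FILE 1's RELATION ON THE TUBE** (the `(χ,τ)` twin of ★
`poleControl_continued_cm_two_of_family_on`): `D₁ ⊆ D⁺` open preconnected ⊇ the sub-tube boxes; bracket letters as in §2; a measure `μ` on the automorphic quotient `X` of
`U(1,1)_{L∕L⁺}`, a measure `ν` on `N(𝔸)`, a set `𝓕`, `T ≥ 1`, a section `φ`; `F : ℂ → L²(X, μ)` holomorphic on `D₁` with `F z = [Λ^T E(φH^z)]` a.e. for `z ∈ D₁`, `Re z > 1`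
(`hFtube`); and THE SOCKET `h4` — the `(χ, τ)` Maass–Selberg relation `∫_X Λ^TE(φ, z)·conj Λ^TE(φ, z′) dμ = R(z, z′; B)` on the sub-tube `1 < Re z′ < Re z` (FILE 1,
K2E1-p14, any bracket bytes).  THEN (a1)∧(a2)∧(a3) for `b` at every `z ∈ D₁`. [cite: MoeglinWaldspurger1995, IV.2.3, IV.3.12 (a)] [cite: Arthur1980TraceFormulaII, §4] -/
theorem poleControl_continued_chi_cm_two_of_truncatedFamily_on {D₁ : Set ℂ} (hD₁ : IsOpen D₁) (hD₁c : IsPreconnected D₁) (hD₁sub : D₁ ⊆ {z : ℂ | 1 / 2 < z.re ∧ 0 < z.im})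
    (hbox₁ : {z : ℂ | (3 < z.re ∧ z.re < 4) ∧ 0 < z.im} ⊆ D₁) (hbox₂ : {z : ℂ | (1 < z.re ∧ z.re < 2) ∧ 0 < z.im} ⊆ D₁)
    (μ : Measure (quasiSplit (↥(maximalRealSubfield L)) L (IsCMField.complexConj L) 2).automorphicQuotient)
    (ν : Measure ↥(adelicUnipotent (↥(maximalRealSubfield L)) L (IsCMField.complexConj L) 2)) (𝓕 : Set ↥(adelicUnipotent (↥(maximalRealSubfield L)) L (IsCMField.complexConj L) 2))
    {T : ℝ≥0} (hT : 1 ≤ T) {cμ K : ℝ} (hcμ : 0 < cμ) (hK : 0 < K) {a : ℝ} (ha : 0 < a) {b : ℂ → ℝ} (hb : ∀ z ∈ D₁, 0 ≤ b z)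
    {B₁ : ℂ} {B₂ B₃ : ℂ → ℂ} {B₄ : ℂ → ℂ → ℂ} (hB₁ : B₁ = ((a : ℝ) : ℂ)) (hB₂ : DifferentiableOn ℂ (fun w : ℂ => B₂ (conj w)) {w : ℂ | conj w ∈ D₁}) (hB₃ : DifferentiableOn ℂ B₃ D₁)
    (hB₃₂ : ∀ z ∈ D₁, B₃ z = conj (B₂ z)) (hB₄₁ : ∀ z' ∈ D₁, DifferentiableOn ℂ (fun z : ℂ => B₄ z z') D₁)
    (hB₄₂ : ∀ z ∈ D₁, DifferentiableOn ℂ (fun w : ℂ => B₄ z (conj w)) {w : ℂ | conj w ∈ D₁}) (hB₄d : ∀ z ∈ D₁, B₄ z z = ((b z : ℝ) : ℂ))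
    (hCS : ∀ z ∈ D₁, ‖B₂ z‖ ^ 2 ≤ a * b z)
    (φ : (quasiSplit (↥(maximalRealSubfield L)) L (IsCMField.complexConj L) 2).Adelic → ℂ)
    (F : ℂ → Lp ℂ 2 μ) (hFd : DifferentiableOn ℂ F D₁)
    (hFtube : ∀ z ∈ D₁, 1 < z.re → ((F z : Lp ℂ 2 μ) : (quasiSplit (↥(maximalRealSubfield L)) L (IsCMField.complexConj L) 2).automorphicQuotient → ℂ) =ᵐ[μ] (quasiSplit (↥(maximalRealSubfield L)) L (IsCMField.complexConj L) 2).quotFun (truncation ν 𝓕 T (eisensteinSeriesU (flatSectionU φ z))))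
    (h4 : ∀ z z' : ℂ, 1 < z'.re → z'.re < z.re →
      ∫ x, (quasiSplit (↥(maximalRealSubfield L)) L (IsCMField.complexConj L) 2).quotFun (truncation ν 𝓕 T (eisensteinSeriesU (flatSectionU φ z))) x * conj ((quasiSplit (↥(maximalRealSubfield L)) L (IsCMField.complexConj L) 2).quotFun (truncation ν 𝓕 T (eisensteinSeriesU (flatSectionU φ z'))) x) ∂μ =
      ((cμ : ℝ) : ℂ) * (((K : ℝ) : ℂ) *
        ((((T : ℝ) : ℂ) ^ (z + conj z' - 1) / (z + conj z' - 1)) * B₁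
          + (((T : ℝ) : ℂ) ^ (z - conj z') / (z - conj z')) * B₂ z'
          - (((T : ℝ) : ℂ) ^ (-(z - conj z')) / (z - conj z')) * B₃ z
          - (((T : ℝ) : ℂ) ^ (-(z + conj z' - 1)) / (z + conj z' - 1)) * B₄ z z')))
    {z : ℂ} (hz : z ∈ D₁) :
    Real.sqrt (b z) ≤ (z.re - 1 / 2) * (T : ℝ) ^ (2 * (z.re - 1 / 2)) * Real.sqrt a / |z.im| +
        Real.sqrt ((z.re - 1 / 2) ^ 2 * (T : ℝ) ^ (4 * (z.re - 1 / 2)) * a / z.im ^ 2 + a * (T : ℝ) ^ (4 * (z.re - 1 / 2))) ∧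
      (∀ {x₁ x₂ η : ℝ}, 0 < x₁ → (z.re - 1 / 2) ∈ Set.Icc x₁ x₂ → 0 < η → η ≤ |z.im| →
        b z ≤ (x₂ * (T : ℝ) ^ (2 * x₂) * Real.sqrt a / η + Real.sqrt (x₂ ^ 2 * (T : ℝ) ^ (4 * x₂) * a / η ^ 2 + a * (T : ℝ) ^ (4 * x₂))) ^ 2) ∧
      (|z.im| ≤ 1 → b z ≤ ((z.re - 1 / 2) * (T : ℝ) ^ (2 * (z.re - 1 / 2)) * Real.sqrt a +
        Real.sqrt ((z.re - 1 / 2) ^ 2 * (T : ℝ) ^ (4 * (z.re - 1 / 2)) * a + a * (T : ℝ) ^ (4 * (z.re - 1 / 2)))) ^ 2 / z.im ^ 2) := by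
  have hraw : ∀ z ∈ D₁, ∀ z' ∈ D₁, 1 < z.re → 1 < z'.re →
      ⟪F z', F z⟫_ℂ = ∫ x, (quasiSplit (↥(maximalRealSubfield L)) L (IsCMField.complexConj L) 2).quotFun (truncation ν 𝓕 T (eisensteinSeriesU (flatSectionU φ z))) x * conj ((quasiSplit (↥(maximalRealSubfield L)) L (IsCMField.complexConj L) 2).quotFun (truncation ν 𝓕 T (eisensteinSeriesU (flatSectionU φ z'))) x) ∂μ := by
    intro z hz z' hz' hz1 hz'1
    rw [MeasureTheory.L2.inner_def]
    refine integral_congr_ae ?_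
    filter_upwards [hFtube z hz hz1, hFtube z' hz' hz'1] with x hx hx'
    rw [hx, hx', RCLike.inner_apply, mul_comm]
  have hrel : ∀ z ∈ D₁, ∀ z' ∈ D₁, 1 < z'.re → z'.re < z.re →
      ⟪F z', F z⟫_ℂ = ((cμ : ℝ) : ℂ) * (((K : ℝ) : ℂ) *
        ((((T : ℝ) : ℂ) ^ (z + conj z' - 1) / (z + conj z' - 1)) * B₁
          + (((T : ℝ) : ℂ) ^ (z - conj z') / (z - conj z')) * B₂ z'
          - (((T : ℝ) : ℂ) ^ (-(z - conj z')) / (z - conj z')) * B₃ z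
          - (((T : ℝ) : ℂ) ^ (-(z + conj z' - 1)) / (z + conj z' - 1)) * B₄ z z')) := by
    intro z hz z' hz' h1 h2
    rw [hraw z hz z' hz' (h1.trans h2) h1]
    exact h4 z z' h1 h2
  exact poleControl_continued_chi_cm_two_of_family_on hD₁ hD₁c hD₁sub hbox₁ hbox₂ (T := (T : ℝ)) (by exact_mod_cast hT) hcμ hK ha hb hB₁ hB₂ hB₃ hB₃₂ hB₄₁ hB₄₂ hB₄d hCS F hFd hrel hz

end Family

end Summit.HodgeConjecture.HodgeConjecture.Cruxes.H413.K2E1ChiMaassSelbergContinuedCMTwo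

end
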